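/-
Copyright (c) 2026 the pub-hodgecm-mathlib formalisation cell (harness21).  Prover seat hodgecm-mathlib-LH7-p07 (g0), Track A «(D-RAM) FOUR-FRAME» squad, helper lane on
h413 = stmt-HodgeConjecture-24833 (count-neutral).  β-BOARD v1, row R8-EQ-b (LH7-p05 (g0) 16:32:34Z): the UNIT-SHELL (`s = 0`) twins of ★ p861670 — the three slot sums
over the glue window of the EQUILATERAL key vanish.  2026-09-04.
-/
import Summits.HodgeConjecture.HodgeConjecture.Theorems.F0P3cDyRamGlueWindowVanishing   -- ★ p861670 (this seat): `hset_of_shell_image`, `sum_normSign_hset_eq_zero`; brings ★ p861614 `image_sub_one_repr`, ★ p861409 `sum_eq_zero_of_classIsometry_flip`, `sum_normSign_mul_one_sub_repr_eq_zero`, `normSign_eq_of_rel_near`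
import HarnessLib

/-!
# Crux `H413`, line LH4 «(D-RAM) FOUR-FRAME» — β-BOARD R8-EQ-b: THE UNIT-SHELL (`s = 0`) TWINS OF ★ p861670 — the three slot class-functions `ω(r + c₀)`, `ω(r(r + c₀))`,
# `ω((1 + r)(r + c₀))` sum to zero over every complete irredundant system of the unit F-shell `{σr = r, |r| = 1, |r + c₀| = |ϖ|^e}` (`c₀` a fixed UNIT with `|1 − c₀| = 1`, `e ≥ 1`),
# hence the three glue-window double sums `Σ_{g ∈ R, |g + c₀| = |ϖ|^e} Σ_{aβ ∈ Aβ} (…)(g + (1+g)(aβ − 1)) = 0` over the fixed UNITS `R` modulo `𝔭ⁿ`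

Cell `hodgecm-mathlib` (D-0151), FLOOR 0, crux item H413 = `stmt-HodgeConjecture-24833`, route `HCCMUnconditional`; squad F0∕P3c∕LH4 (this seat re-dealt from F0∕P3c∕LH7).
THEOREMS ONLY (no `def`, no instance, no notation, no `sorry`, default heartbeats); ★-only imports; lane `--supports stmt-HodgeConjecture-24833 --as helper` (count-neutral);
pays NO row, states NO law.

WHY (LH7-p05 (g0), 2026-09-04 16:32:34Z, row R8-EQ-b «H(ρ) above the locus on the EQUILATERAL key `n₁ = n₂ = n₃ = m`»).  There the glue parameter `g` is a UNIT, `c₀ = g_β∕g_α`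
is a fixed unit with `1 − c₀` a unit, the clean shell cuts the window class `|g + c₀| = |ϖ|^E` (`E = 2ρ + ℓ₀ − m ≥ 2`), and the per-representative head is again a class sign times
one of `ω(r + c₀)`, `ω(r(r + c₀))`, `ω((1 + r)(r + c₀))` at `r = g + (1+g)(aβ − 1)`, a fixed UNIT with `|r + c₀| = |ϖ|^e`.  ★ p861670 proved the three window sums for `|c₀| =
|g| = |ϖ|^s`, `1 ≤ s`, using `1 ≤ s` only (i) to make `1 + g` a unit and (ii) to give the affine factor `1 − c₀ + c₀h` (`h = 1 + r∕c₀`) a norm margin under the flip `h ↦ c·h`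
(`c` the ★ non-norm fixed unit, `|c − 1| ≤ |ϖ|^{2d−2}`; the factor moves by `c₀(c − 1)h` of depth `s + (2d − 2) + e`).  At `s = 0` both are repaid by the CUT: `1 + g = (1 − c₀) +
(g + c₀)` is a unit because `|1 − c₀| = 1` and `e ≥ 1`; `|h| = |ϖ|^e ≤ |ϖ|` supplies the margin `(2d − 2) + e ≥ 2d − 1`; `|1 − c₀ + c₀h| = 1` again by `|1 − c₀| = 1`.  Everything
else is ★ and `s`-free (★ `hset_of_shell_image`, ★ `sum_normSign_hset_eq_zero`, ★ p861409 `sum_normSign_mul_one_sub_repr_eq_zero`, ★ p861614 `image_sub_one_repr`, the engine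
★ `sum_eq_zero_of_classIsometry_flip`).
WHAT IS PROVED (letters: `σc₀ = c₀`, `|c₀| = 1`, `|1 − c₀| = 1`; `R` a complete irredundant system modulo `𝔭ⁿ` of the fixed UNITS (`hR1 : σg = g ∧ |g| = 1`); `Aβ` and the
arithmetic `n ≤ 2M`, `2M ≤ k + d ≤ 2M + 1`, `d ≤ M ≤ k` VERBATIM as ★ p861670; the cut `|g + c₀| = |ϖ|^e` with `1 ≤ e < n`, `e + 2d − 1 ≤ 2M`).
* §1 `one_add_eq_of_cut` (`|1 + g| = 1` on the cut), `hset_letters_unit`, `v_sub_le_and_of_v_linear_sub_le_unit` (the key letter of ★ p861522 with `|1 + g| = 1` as input).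
* §2 FLIP 2 at `s = 0`: **`sum_normSign_mul_affine_hset_eq_zero_unit`** — `Σ_{h} ω(h·(1 − c₀ + c₀h)) = 0` over a system of `{σh = h, |h| = |ϖ|^E, |1 − h| = 1}` modulo `𝔭^{N′}`,
  `1 ≤ E`, `E + 2d − 1 ≤ N′`.
* §3 the three slot sums over any system `Sh` of the unit shell modulo `𝔭^N` (`1 ≤ e`, `e + 2d − 1 ≤ N`): **`sum_normSign_add_shell_eq_zero_unit`**,
  **`sum_normSign_mul_add_shell_eq_zero_unit`**, **`sum_normSign_one_add_mul_add_shell_eq_zero_unit`**.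
* §4 the `s = 0` linearisation `(g, b) ↦ g + (1+g)b` of `R.filter cut ×ˢ B` onto a system of the unit shell (`glueShell_image_sub_unit ∕ _complete_unit ∕ _irredundant_unit`,
  `glueShell_injOn_unit`, `sum_sum_glueShell_eq_sum_image_unit`) and **`sum_filter_sum_eq_zero_of_shell_unit`**.
* §5 HEADS: **`sum_filter_sum_normSign_add_eq_zero_unit`** (`G₁ = ω(r + c₀)`), **`sum_filter_sum_normSign_mul_add_eq_zero_unit`** (`G₀ = ω(r(r + c₀))`),
  **`sum_filter_sum_normSign_one_add_mul_add_eq_zero_unit`** (`G₂ = ω((1+r)(r + c₀))`) — binder order as ★ p861670 with `(hc₀ : |c₀| = 1) (h1c₀ : |1 − c₀| = 1)` replacing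
  `(hs : 1 ≤ s) (hc₀ : |c₀| = |ϖ|^s)`, `(he : 1 ≤ e)` replacing `(hse : s ≤ e)`, `(hn : 1 ≤ n)` replacing `(hsn : s < n)`, and `hR1 : σ g = g ∧ Valued.v g = 1`.
HONEST LABEL.  Finite character sums over a valuation ring; count-neutral (`--supports`); pays no registered stub, touches no `Lines/` module, states no census law; row R8-EQ, the
H-line junction `hH`, `hRest`, (β-BAL), (β), T₊ remain OPEN; `HC_CM` is proved only modulo the 7 printed citations (2 remaining named inputs: hLiu418 = `stmt-HodgeConjecture-24832`,
h413 = `stmt-HodgeConjecture-24833`) until rung 0 closes.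

## References
* [Serre1979] J.-P. Serre, *Local Fields*, GTM 67 (1979), Ch. II §1 (residue systems), Ch. V §3 Cor. 3 (norm groups of ramified quadratic extensions), Ch. XV §2 (norm residue symbol).
* [IrelandRosen1990] K. Ireland, M. Rosen, *A Classical Introduction to Modern Number Theory*, GTM 84 (1990), Ch. 8 §3 (vanishing of twisted multiplicative character sums).
-/

set_option autoImplicit false

namespace Summit.HodgeConjecture.HodgeConjecture.Cruxes.H413.F0P3cDyRamGlueWindowVanishingUnit

open WithZero
open scoped Valued
open Literature.NumberTheory.Automorphic.UnitaryThreeFourFrame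
open Literature.NumberTheory.LocalFields.WildQuadraticDatum
open Summit.HodgeConjecture.HodgeConjecture.Cruxes.H413.F0P3cDyRamGlueShellLinearisation (v_pow_le_pow_iff v_pow_lt_pow_iff)
open Summit.HodgeConjecture.HodgeConjecture.Cruxes.H413.F0P3cDyRamGlueWindowSum (image_sub_one_repr)
open Summit.HodgeConjecture.HodgeConjecture.Cruxes.H413.F0P3cDyRamGlueClassCharSums
open Summit.HodgeConjecture.HodgeConjecture.Cruxes.H413.F0P3cDyRamGlueWindowVanishing (hset_of_shell_image sum_normSign_hset_eq_zero)
open Summit.HodgeConjecture.HodgeConjecture.Cruxes.H413.F0P3cDyRamFixedCountDiagonalModel (normSign_mul_norm)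

variable {K : Type} [Field K] [Valued K ℤᵐ⁰] {σ : K →+* K} {ϖ : K} {d t : ℕ}

/-! ## §1  Letters at `s = 0` -/

/-- **ON THE CUT `1 + g` IS A UNIT**: `|1 − c₀| = 1`, `|g + c₀| = |ϖ|^e`, `1 ≤ e` ⇒ `|1 + g| = 1` (`1 + g = (1 − c₀) + (g + c₀)`). [cite: Serre1979, Ch. II §1] -/
theorem one_add_eq_of_cut (hϖ : Valued.v ϖ = exp (-1 : ℤ)) {e : ℕ} (he : 1 ≤ e) {c₀ g : K} (h1c₀ : Valued.v (1 - c₀) = 1)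
    (hge : Valued.v (g + c₀) = Valued.v ϖ ^ e) : Valued.v (1 + g) = 1 := by
  rw [show 1 + g = (1 - c₀) + (g + c₀) by ring, Valuation.map_add_eq_of_lt_left _ ?_, h1c₀]
  rw [h1c₀, hge, ← pow_zero (Valued.v ϖ)]; exact (v_pow_lt_pow_iff hϖ _ _).2 (by omega)

/-- **THE `s = 0` h-SET LETTERS**: for a fixed unit `c₀` with `|1 − c₀| = 1` and a fixed `h` with `|h| = |ϖ|^E`, `1 ≤ E`: `h ≠ 0`, `|h| ≤ 1`, `|c₀h| < 1`, `1 − c₀ + c₀h` is a fixed UNIT.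
[cite: Serre1979, Ch. II §1] -/
theorem hset_letters_unit (hϖ : Valued.v ϖ = exp (-1 : ℤ)) {E : ℕ} (hE : 1 ≤ E) {c₀ : K} (hσc₀ : σ c₀ = c₀) (hc₀ : Valued.v c₀ = 1) (h1c₀ : Valued.v (1 - c₀) = 1)
    {h : K} (hσh : σ h = h) (hvh : Valued.v h = Valued.v ϖ ^ E) :
    h ≠ 0 ∧ Valued.v h ≤ 1 ∧ Valued.v (c₀ * h) < 1 ∧ σ (1 - c₀ + c₀ * h) = 1 - c₀ + c₀ * h ∧ Valued.v (1 - c₀ + c₀ * h) = 1 := by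
  have hvϖ0 : Valued.v ϖ ≠ 0 := by rw [hϖ]; exact exp_ne_zero
  have hh0 : h ≠ 0 := fun h0 => by rw [h0, map_zero] at hvh; exact pow_ne_zero _ hvϖ0 hvh.symm
  have hhlt : Valued.v h < 1 := by rw [hvh, ← pow_zero (Valued.v ϖ)]; exact (v_pow_lt_pow_iff hϖ _ _).2 (by omega)
  have hc₀h : Valued.v (c₀ * h) < 1 := by rw [map_mul, hc₀, one_mul]; exact hhlt
  exact ⟨hh0, hhlt.le, hc₀h, by rw [map_add, map_sub, map_one, map_mul, hσc₀, hσh], by rw [Valuation.map_add_eq_of_lt_left _ (by rw [h1c₀]; exact hc₀h), h1c₀]⟩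

/-- **THE KEY LETTER OF L4a WITH `|1 + g| = 1` AS INPUT** (★ p861522 `v_sub_le_and_of_v_linear_sub_le` used `1 ≤ s` only for this): `|b|, |b′| ≤ |ϖ|^n`, `1 ≤ n ≤ N`,
`|(g + (1+g)b) − (g′ + (1+g′)b′)| ≤ |ϖ|^N` ⇒ `|g − g′| ≤ |ϖ|^n`, and once `g = g′`, `|b − b′| ≤ |ϖ|^N`. [cite: Serre1979, Ch. II §1] -/
theorem v_sub_le_and_of_v_linear_sub_le_unit (hϖ : Valued.v ϖ = exp (-1 : ℤ)) {n N : ℕ} (hn : 1 ≤ n) (hnN : n ≤ N)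
    {g g' b b' : K} (h1g : Valued.v (1 + g) = 1) (hb : Valued.v b ≤ Valued.v ϖ ^ n) (hb' : Valued.v b' ≤ Valued.v ϖ ^ n)
    (h : Valued.v ((g + (1 + g) * b) - (g' + (1 + g') * b')) ≤ Valued.v ϖ ^ N) :
    Valued.v (g - g') ≤ Valued.v ϖ ^ n ∧ (g = g' → Valued.v (b - b') ≤ Valued.v ϖ ^ N) := by
  have hnN' : Valued.v ϖ ^ N ≤ Valued.v ϖ ^ n := (v_pow_le_pow_iff hϖ _ _).2 hnN
  have hb'1 : Valued.v b' < 1 := lt_of_le_of_lt hb' (by rw [← pow_zero (Valued.v ϖ)]; exact (v_pow_lt_pow_iff hϖ _ _).2 (by omega))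
  have hu : Valued.v (1 + b') = 1 := Valued.v.map_one_add_of_lt hb'1
  have e : (g + (1 + g) * b) - (g' + (1 + g') * b') = (g - g') * (1 + b') + (1 + g) * (b - b') := by ring
  rw [e] at h
  have hsecond : Valued.v ((1 + g) * (b - b')) ≤ Valued.v ϖ ^ n := by rw [map_mul, h1g, one_mul]; exact (Valuation.map_sub _ _ _).trans (max_le hb hb')
  constructor
  · have hfirst : Valued.v ((g - g') * (1 + b')) ≤ Valued.v ϖ ^ n := by
      rw [show (g - g') * (1 + b') = ((g - g') * (1 + b') + (1 + g) * (b - b')) - (1 + g) * (b - b') by ring]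
      exact (Valuation.map_sub _ _ _).trans (max_le (h.trans hnN') hsecond)
    rwa [map_mul, hu, mul_one] at hfirst
  · rintro rfl
    rwa [sub_self, zero_mul, zero_add, map_mul, h1g, one_mul] at h

/-! ## §2  FLIP 2 at `s = 0`: `Σ_{h} ω(h·(1 − c₀ + c₀h)) = 0` -/

/-- **FLIP 2 ON THE h-SET, `s = 0`**: over a complete irredundant system modulo `𝔭^{N′}` of `{σh = h, |h| = |ϖ|^E, |1 − h| = 1}` (`2 ≤ d`, `1 ≤ E`, `E + 2d − 1 ≤ N′`; `c₀` a fixed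
unit with `|1 − c₀| = 1`), `Σ ω(h·(1 − c₀ + c₀h)) = 0`: the flip `h ↦ c·h` moves the unit `1 − c₀ + c₀h` by `c₀(c − 1)h`, of depth `(2d − 2) + E ≥ 2d − 1`.
[cite: Serre1979, Ch. V §3 Cor. 3; Ch. XV §2] -/
theorem sum_normSign_mul_affine_hset_eq_zero_unit [CompleteSpace K] [Finite 𝓀[K]] (hD : IsRamifiedQuadraticDatum σ ϖ d t) (h2v : Valued.v (2 : K) < 1) (h2d : 2 ≤ d)
    {c₀ : K} (hσc₀ : σ c₀ = c₀) (hc₀ : Valued.v c₀ = 1) (h1c₀ : Valued.v (1 - c₀) = 1)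
    {E : ℕ} (hE : 1 ≤ E) {N' : ℕ} (hN : E + (2 * d - 1) ≤ N') (S : Finset K) (hS1 : ∀ h ∈ S, σ h = h ∧ Valued.v h = Valued.v ϖ ^ E ∧ Valued.v (1 - h) = 1)
    (hS2 : ∀ h : K, σ h = h → Valued.v h = Valued.v ϖ ^ E → Valued.v (1 - h) = 1 → ∃ x ∈ S, Valued.v (h - x) ≤ Valued.v ϖ ^ N')
    (hS3 : ∀ x ∈ S, ∀ x' ∈ S, Valued.v (x - x') ≤ Valued.v ϖ ^ N' → x = x') :
    ∑ h ∈ S, normSign σ (h * (1 - c₀ + c₀ * h)) = 0 := by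
  obtain ⟨-, -, hϖ, -, -, -, -⟩ := id hD
  have hϖ1 : Valued.v ϖ ≤ 1 := by rw [hϖ, ← exp_zero]; exact exp_le_exp.2 (by norm_num)
  obtain ⟨c, hσc, hc1, hcd, hcn⟩ := exists_fixed_unit_not_norm_v_sub_one_le hD h2v
  have hc1lt : Valued.v (c - 1) < 1 := lt_of_le_of_lt hcd (by rw [← exp_zero, exp_lt_exp]; omega)
  have hcd' : Valued.v (c - 1) ≤ Valued.v ϖ ^ (2 * (d - 1)) := by rw [v_varpi_pow hϖ]; exact_mod_cast hcd
  have hNle : Valued.v ϖ ^ N' ≤ Valued.v ϖ ^ (2 * d - 1) * Valued.v ϖ ^ E := by rw [← pow_add]; exact pow_le_pow_right_of_le_one' hϖ1 (by omega)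
  have hL : ∀ h : K, σ h = h → Valued.v h = Valued.v ϖ ^ E →
      h ≠ 0 ∧ Valued.v h ≤ 1 ∧ Valued.v (c₀ * h) < 1 ∧ σ (1 - c₀ + c₀ * h) = 1 - c₀ + c₀ * h ∧ Valued.v (1 - c₀ + c₀ * h) = 1 :=
    fun h hσh hvh => hset_letters_unit hϖ hE hσc₀ hc₀ h1c₀ hσh hvh
  refine sum_eq_zero_of_classIsometry_flip (A := {h : K | σ h = h ∧ Valued.v h = Valued.v ϖ ^ E ∧ Valued.v (1 - h) = 1}) S hS1
    (fun h hh => hS2 h hh.1 hh.2.1 hh.2.2) hS3 (fun h => c * h) ?_ ?_ (fun h => normSign σ (h * (1 - c₀ + c₀ * h))) ?_ ?_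
  · rintro h ⟨hσh, hvh, h1h⟩
    refine ⟨by rw [map_mul, hσc, hσh], by rw [map_mul, hc1, one_mul, hvh], ?_⟩
    have hh1 : Valued.v h ≤ 1 := by rw [hvh]; exact pow_le_one₀ zero_le hϖ1
    rw [show 1 - c * h = (1 - h) - (c - 1) * h by ring, Valuation.map_sub_eq_of_lt_left _ ?_, h1h]
    rw [h1h, map_mul]
    exact mul_lt_one_of_nonneg_of_lt_one_left zero_le hc1lt hh1
  · rintro h - h' -
    rw [← mul_sub, map_mul, hc1, one_mul]
  · rintro h ⟨hσh, hvh, -⟩ h' ⟨hσh', hvh', -⟩ hhh'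
    obtain ⟨hh0, -, -, hσu, hvu⟩ := hL h hσh hvh
    obtain ⟨-, -, hc₀h', hσu', -⟩ := hL h' hσh' hvh'
    have hu0 : 1 - c₀ + c₀ * h ≠ 0 := fun h0 => by rw [h0, map_zero] at hvu; exact zero_ne_one hvu
    refine (normSign_eq_of_rel_near hD (by rw [map_mul, hσh, hσu]) (by rw [map_mul, hσh', hσu']) (mul_ne_zero hh0 hu0) le_rfl ?_).symm
    rw [show h * (1 - c₀ + c₀ * h) - h' * (1 - c₀ + c₀ * h') = (h - h') * (1 - c₀ + c₀ * (h + h')) by ring, map_mul, map_mul, hvu, mul_one, hvh]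
    have hle : Valued.v (1 - c₀ + c₀ * (h + h')) ≤ 1 := by
      rw [show 1 - c₀ + c₀ * (h + h') = (1 - c₀ + c₀ * h) + c₀ * h' by ring]
      exact (Valuation.map_add _ _ _).trans (max_le (le_of_eq hvu) hc₀h'.le)
    calc Valued.v (h - h') * Valued.v (1 - c₀ + c₀ * (h + h')) ≤ Valued.v ϖ ^ N' * 1 := mul_le_mul' hhh' hle
      _ ≤ Valued.v ϖ ^ (2 * d - 1) * Valued.v ϖ ^ E := by rw [mul_one]; exact hNle
  · rintro h ⟨hσh, hvh, -⟩
    obtain ⟨hh0, -, -, hσu, hvu⟩ := hL h hσh hvh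
    have hu0 : 1 - c₀ + c₀ * h ≠ 0 := fun h0 => by rw [h0, map_zero] at hvu; exact zero_ne_one hvu
    have hσhu' : σ (h * (1 - c₀ + c₀ * (c * h))) = h * (1 - c₀ + c₀ * (c * h)) := by
      rw [map_mul, map_add, map_sub, map_one, map_mul, map_mul, hσh, hσc₀, hσc]
    have hnear : normSign σ (h * (1 - c₀ + c₀ * (c * h))) = normSign σ (h * (1 - c₀ + c₀ * h)) := by
      refine normSign_eq_of_rel_near hD (by rw [map_mul, hσh, hσu]) hσhu' (mul_ne_zero hh0 hu0) le_rfl ?_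
      have hx : Valued.v (h * (1 - c₀ + c₀ * h)) = Valued.v h := by rw [map_mul, hvu, mul_one]
      rw [hx, show h * (1 - c₀ + c₀ * h) - h * (1 - c₀ + c₀ * (c * h)) = -((c₀ * (c - 1) * h) * h) by ring, Valuation.map_neg, map_mul]
      refine mul_le_mul' ?_ le_rfl
      rw [map_mul, map_mul, hc₀, hvh, one_mul]
      calc Valued.v (c - 1) * Valued.v ϖ ^ E ≤ Valued.v ϖ ^ (2 * (d - 1)) * Valued.v ϖ ^ 1 := mul_le_mul' hcd' (pow_le_pow_right_of_le_one' hϖ1 hE)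
        _ = Valued.v ϖ ^ (2 * d - 1) := by rw [← pow_add]; congr 1; omega
    show normSign σ (c * h * (1 - c₀ + c₀ * (c * h))) = -normSign σ (h * (1 - c₀ + c₀ * h))
    rw [mul_assoc, normSign_mul_eq_neg_of_not_norm hD hσc hcn hσhu' (mul_ne_zero hh0 (fun h0 => ?_)), hnear]
    have := (hset_letters_unit hϖ hE hσc₀ hc₀ h1c₀ (h := c * h) (by rw [map_mul, hσc, hσh]) (by rw [map_mul, hc1, one_mul, hvh])).2.2.2.2
    rw [h0, map_zero] at this; exact zero_ne_one this

/-! ## §3  The three slot sums over any system of the unit shell -/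

section Slots

variable [CompleteSpace K] [Finite 𝓀[K]] [DecidableEq K]

/-- **SLOT 1, `s = 0`: `Σ_{r ∈ Sh} ω(r + c₀) = 0`** over any complete irredundant system modulo `𝔭^N` of `{σr = r, |r| = 1, |r + c₀| = |ϖ|^e}` (`2 ≤ d`, `1 ≤ e`, `e + 2d − 1 ≤ N`,
`c₀` a fixed unit with `|1 − c₀| = 1`): `r + c₀ = c₀·h` and FLIP 1 ★ `sum_normSign_hset_eq_zero`. [cite: Serre1979, Ch. V §3 Cor. 3; Ch. XV §2] -/
theorem sum_normSign_add_shell_eq_zero_unit (hD : IsRamifiedQuadraticDatum σ ϖ d t) (h2v : Valued.v (2 : K) < 1) (h2d : 2 ≤ d)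
    {e N : ℕ} (he : 1 ≤ e) (hN : e + (2 * d - 1) ≤ N) {c₀ : K} (hσc₀ : σ c₀ = c₀) (hc₀ : Valued.v c₀ = 1) (h1c₀ : Valued.v (1 - c₀) = 1)
    (Sh : Finset K) (hSh1 : ∀ r ∈ Sh, σ r = r ∧ Valued.v r = Valued.v ϖ ^ 0 ∧ Valued.v (r + c₀) = Valued.v ϖ ^ e)
    (hSh2 : ∀ r : K, σ r = r → Valued.v r = Valued.v ϖ ^ 0 → Valued.v (r + c₀) = Valued.v ϖ ^ e → ∃ x ∈ Sh, Valued.v (r - x) ≤ Valued.v ϖ ^ N)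
    (hSh3 : ∀ x ∈ Sh, ∀ x' ∈ Sh, Valued.v (x - x') ≤ Valued.v ϖ ^ N → x = x') :
    ∑ r ∈ Sh, normSign σ (r + c₀) = 0 := by
  obtain ⟨-, -, hϖ, -, -, -, -⟩ := id hD
  have hc₀0 : c₀ ≠ 0 := fun h0 => by rw [h0, map_zero] at hc₀; exact zero_ne_one hc₀
  obtain ⟨hB1, hB2, hB3, hsum⟩ := hset_of_shell_image hϖ (Nat.zero_le e) (Nat.zero_le N) hσc₀ (by rw [hc₀, pow_zero]) Sh hSh1 hSh2 hSh3 (fun h => normSign σ h)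
  simp only [Nat.sub_zero] at hB1 hB2 hB3
  have hterm : ∀ r ∈ Sh, normSign σ (r + c₀) = normSign σ c₀ * normSign σ (1 + r / c₀) := fun r hr => by
    obtain ⟨hσh, hvh, -⟩ := hB1 _ (Finset.mem_image.2 ⟨r, hr, rfl⟩)
    have hh0 := (hset_letters_unit hϖ he hσc₀ hc₀ h1c₀ hσh hvh).1
    rw [show r + c₀ = c₀ * (1 + r / c₀) by rw [mul_add, mul_one, mul_div_cancel₀ r hc₀0, add_comm], normSign_mul_of_fixed hD hσc₀ hσh hc₀0 hh0]
  rw [Finset.sum_congr rfl hterm, ← Finset.mul_sum, hsum, sum_normSign_hset_eq_zero hD h2v h2d e hN _ hB1 hB2 hB3, mul_zero]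

/-- **SLOT 0, `s = 0`: `Σ_{r ∈ Sh} ω(r·(r + c₀)) = 0`** (same data): `r(r + c₀) = (c₀σc₀)·(−1)·(h(1 − h))` and the Möbius flip ★ p861409 (s0).
[cite: IrelandRosen1990, Ch. 8 §3] [cite: Serre1979, Ch. XV §2] -/
theorem sum_normSign_mul_add_shell_eq_zero_unit (hD : IsRamifiedQuadraticDatum σ ϖ d t) (h2v : Valued.v (2 : K) < 1) (h2d : 2 ≤ d)
    {e N : ℕ} (he : 1 ≤ e) (hN : e + (2 * d - 1) ≤ N) {c₀ : K} (hσc₀ : σ c₀ = c₀) (hc₀ : Valued.v c₀ = 1) (h1c₀ : Valued.v (1 - c₀) = 1)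
    (Sh : Finset K) (hSh1 : ∀ r ∈ Sh, σ r = r ∧ Valued.v r = Valued.v ϖ ^ 0 ∧ Valued.v (r + c₀) = Valued.v ϖ ^ e)
    (hSh2 : ∀ r : K, σ r = r → Valued.v r = Valued.v ϖ ^ 0 → Valued.v (r + c₀) = Valued.v ϖ ^ e → ∃ x ∈ Sh, Valued.v (r - x) ≤ Valued.v ϖ ^ N)
    (hSh3 : ∀ x ∈ Sh, ∀ x' ∈ Sh, Valued.v (x - x') ≤ Valued.v ϖ ^ N → x = x') :
    ∑ r ∈ Sh, normSign σ (r * (r + c₀)) = 0 := by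
  obtain ⟨-, -, hϖ, -, -, -, -⟩ := id hD
  have hc₀0 : c₀ ≠ 0 := fun h0 => by rw [h0, map_zero] at hc₀; exact zero_ne_one hc₀
  have hσm1 : σ (-1 : K) = -1 := by rw [map_neg, map_one]
  obtain ⟨hB1, hB2, hB3, hsum⟩ := hset_of_shell_image hϖ (Nat.zero_le e) (Nat.zero_le N) hσc₀ (by rw [hc₀, pow_zero]) Sh hSh1 hSh2 hSh3 (fun h => normSign σ (h * (1 - h)))
  simp only [Nat.sub_zero] at hB1 hB2 hB3
  have hterm : ∀ r ∈ Sh, normSign σ (r * (r + c₀)) = normSign σ (-1) * normSign σ ((1 + r / c₀) * (1 - (1 + r / c₀))) := fun r hr => by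
    obtain ⟨hσh, hvh, h1h⟩ := hB1 _ (Finset.mem_image.2 ⟨r, hr, rfl⟩)
    have hh0 := (hset_letters_unit hϖ he hσc₀ hc₀ h1c₀ hσh hvh).1
    have h1h0 : 1 - (1 + r / c₀) ≠ 0 := fun h0 => by rw [h0, map_zero] at h1h; exact zero_ne_one h1h
    have e1 : r * (r + c₀) = (-1 * ((1 + r / c₀) * (1 - (1 + r / c₀)))) * (c₀ * σ c₀) := by rw [hσc₀]; field_simp; ring
    rw [e1, normSign_mul_norm σ _ hc₀0, normSign_mul_of_fixed hD hσm1 (by rw [map_mul, map_sub, map_one, hσh]) (by norm_num) (mul_ne_zero hh0 h1h0)]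
  rw [Finset.sum_congr rfl hterm, ← Finset.mul_sum, hsum, sum_normSign_mul_one_sub_repr_eq_zero hD h2v h2d e hN _ hB1 hB2 hB3, mul_zero]

/-- **SLOT 2, `s = 0`: `Σ_{r ∈ Sh} ω((1 + r)·(r + c₀)) = 0`** (same data): `(1 + r)(r + c₀) = c₀·(h·(1 − c₀ + c₀h))` and FLIP 2 (§2). [cite: Serre1979, Ch. V §3 Cor. 3; Ch. XV §2] -/
theorem sum_normSign_one_add_mul_add_shell_eq_zero_unit (hD : IsRamifiedQuadraticDatum σ ϖ d t) (h2v : Valued.v (2 : K) < 1) (h2d : 2 ≤ d)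
    {e N : ℕ} (he : 1 ≤ e) (hN : e + (2 * d - 1) ≤ N) {c₀ : K} (hσc₀ : σ c₀ = c₀) (hc₀ : Valued.v c₀ = 1) (h1c₀ : Valued.v (1 - c₀) = 1)
    (Sh : Finset K) (hSh1 : ∀ r ∈ Sh, σ r = r ∧ Valued.v r = Valued.v ϖ ^ 0 ∧ Valued.v (r + c₀) = Valued.v ϖ ^ e)
    (hSh2 : ∀ r : K, σ r = r → Valued.v r = Valued.v ϖ ^ 0 → Valued.v (r + c₀) = Valued.v ϖ ^ e → ∃ x ∈ Sh, Valued.v (r - x) ≤ Valued.v ϖ ^ N)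
    (hSh3 : ∀ x ∈ Sh, ∀ x' ∈ Sh, Valued.v (x - x') ≤ Valued.v ϖ ^ N → x = x') :
    ∑ r ∈ Sh, normSign σ ((1 + r) * (r + c₀)) = 0 := by
  obtain ⟨-, -, hϖ, -, -, -, -⟩ := id hD
  have hc₀0 : c₀ ≠ 0 := fun h0 => by rw [h0, map_zero] at hc₀; exact zero_ne_one hc₀
  obtain ⟨hB1, hB2, hB3, hsum⟩ := hset_of_shell_image hϖ (Nat.zero_le e) (Nat.zero_le N) hσc₀ (by rw [hc₀, pow_zero]) Sh hSh1 hSh2 hSh3 (fun h => normSign σ (h * (1 - c₀ + c₀ * h)))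
  simp only [Nat.sub_zero] at hB1 hB2 hB3
  have hterm : ∀ r ∈ Sh, normSign σ ((1 + r) * (r + c₀)) = normSign σ c₀ * normSign σ ((1 + r / c₀) * (1 - c₀ + c₀ * (1 + r / c₀))) := fun r hr => by
    obtain ⟨hσh, hvh, -⟩ := hB1 _ (Finset.mem_image.2 ⟨r, hr, rfl⟩)
    obtain ⟨hh0, -, -, hσu, hvu⟩ := hset_letters_unit hϖ he hσc₀ hc₀ h1c₀ hσh hvh
    have hu0 : 1 - c₀ + c₀ * (1 + r / c₀) ≠ 0 := fun h0 => by rw [h0, map_zero] at hvu; exact zero_ne_one hvu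
    rw [show (1 + r) * (r + c₀) = c₀ * ((1 + r / c₀) * (1 - c₀ + c₀ * (1 + r / c₀))) by field_simp; ring,
      normSign_mul_of_fixed hD hσc₀ (by rw [map_mul, hσh, hσu]) hc₀0 (mul_ne_zero hh0 hu0)]
  rw [Finset.sum_congr rfl hterm, ← Finset.mul_sum, hsum, sum_normSign_mul_affine_hset_eq_zero_unit hD h2v h2d hσc₀ hc₀ h1c₀ he hN _ hB1 hB2 hB3, mul_zero]

end Slots

/-! ## §4  The `s = 0` linearisation `(g, b) ↦ g + (1+g)·b` of `R.filter cut ×ˢ B` onto a system of the unit shell -/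

section Linearisation

variable [DecidableEq K]

/-- (a) THE IMAGE LIES IN THE UNIT SHELL: `r = g + (1+g)b` is fixed, `|r| = 1`, `|r + c₀| = |ϖ|^e` (`g` a fixed unit in the cut, `|b| ≤ |ϖ|^n`, `1 ≤ n`, `e < n`). [cite: Serre1979, Ch. II §1] -/
theorem glueShell_image_sub_unit (hϖ : Valued.v ϖ = exp (-1 : ℤ)) {e n : ℕ} (hn : 1 ≤ n) (hen : e < n) {c₀ : K}
    (R : Finset K) (hR1 : ∀ g ∈ R, σ g = g ∧ Valued.v g = 1) (B : Finset K) (hB1 : ∀ b ∈ B, σ b = b ∧ Valued.v b ≤ Valued.v ϖ ^ n) :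
    ∀ r ∈ ((R.filter fun g => Valued.v (g + c₀) = Valued.v ϖ ^ e) ×ˢ B).image (fun p : K × K => p.1 + (1 + p.1) * p.2),
      σ r = r ∧ Valued.v r = Valued.v ϖ ^ 0 ∧ Valued.v (r + c₀) = Valued.v ϖ ^ e := by
  intro r hr
  obtain ⟨⟨g, b⟩, hgb, rfl⟩ := Finset.mem_image.1 hr
  obtain ⟨hg, hb⟩ := Finset.mem_product.1 hgb
  obtain ⟨hgR, hge⟩ := Finset.mem_filter.1 hg
  obtain ⟨hσg, hvg⟩ := hR1 g hgR
  obtain ⟨hσb, hvb⟩ := hB1 b hb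
  have h1g : Valued.v (1 + g) ≤ 1 := (Valuation.map_add _ _ _).trans (max_le (le_of_eq (map_one _)) hvg.le)
  have hdeep : Valued.v ((1 + g) * b) ≤ Valued.v ϖ ^ n := by rw [map_mul]; exact mul_le_of_le_one_of_le h1g hvb
  refine ⟨by simp only [map_add, map_mul, map_one, hσg, hσb], ?_, ?_⟩
  · dsimp only
    rw [pow_zero, Valuation.map_add_eq_of_lt_left _ (lt_of_le_of_lt hdeep (by rw [hvg, ← pow_zero (Valued.v ϖ)]; exact (v_pow_lt_pow_iff hϖ _ _).2 (by omega))), hvg]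
  · dsimp only
    rw [show g + (1 + g) * b + c₀ = (g + c₀) + (1 + g) * b by ring,
      Valuation.map_add_eq_of_lt_left _ (lt_of_le_of_lt hdeep (by rw [hge]; exact (v_pow_lt_pow_iff hϖ _ _).2 hen)), hge]

/-- (b) THE IMAGE IS COMPLETE modulo `𝔭^N` for the unit shell (`R` complete modulo `𝔭ⁿ` for the fixed units, `B` complete modulo `𝔭^N` for the fixed ball `|b| ≤ |ϖ|ⁿ`; `1 ≤ e < n`,
`|1 − c₀| = 1`). [cite: Serre1979, Ch. II §1] -/
theorem glueShell_image_complete_unit (hϖ : Valued.v ϖ = exp (-1 : ℤ)) {e n N : ℕ} (he : 1 ≤ e) (hen : e < n) {c₀ : K} (h1c₀ : Valued.v (1 - c₀) = 1)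
    (R : Finset K) (hR1 : ∀ g ∈ R, σ g = g ∧ Valued.v g = 1)
    (hR2 : ∀ f : K, σ f = f → Valued.v f = 1 → ∃ g ∈ R, Valued.v (f - g) ≤ Valued.v ϖ ^ n)
    (B : Finset K) (hB2 : ∀ b : K, σ b = b → Valued.v b ≤ Valued.v ϖ ^ n → ∃ b' ∈ B, Valued.v (b - b') ≤ Valued.v ϖ ^ N) :
    ∀ r : K, σ r = r → Valued.v r = Valued.v ϖ ^ 0 → Valued.v (r + c₀) = Valued.v ϖ ^ e →
      ∃ x ∈ ((R.filter fun g => Valued.v (g + c₀) = Valued.v ϖ ^ e) ×ˢ B).image (fun p : K × K => p.1 + (1 + p.1) * p.2), Valued.v (r - x) ≤ Valued.v ϖ ^ N := by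
  intro r hσr hvr hre
  rw [pow_zero] at hvr
  obtain ⟨g, hgR, hrg⟩ := hR2 r hσr hvr
  obtain ⟨hσg, -⟩ := hR1 g hgR
  have hge : Valued.v (g + c₀) = Valued.v ϖ ^ e := by
    rw [show g + c₀ = (r + c₀) - (r - g) by ring, Valuation.map_sub_eq_of_lt_left _ (by rw [hre]; exact lt_of_le_of_lt hrg ((v_pow_lt_pow_iff hϖ _ _).2 hen)), hre]
  have h1g : Valued.v (1 + g) = 1 := one_add_eq_of_cut hϖ he h1c₀ hge
  have h1g0 : 1 + g ≠ 0 := fun h0 => by rw [h0, map_zero] at h1g; exact zero_ne_one h1g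
  set b₀ : K := (r - g) / (1 + g) with hb₀
  have hσb₀ : σ b₀ = b₀ := by rw [hb₀, map_div₀, map_sub, map_add, map_one, hσr, hσg]
  have hvb₀ : Valued.v b₀ ≤ Valued.v ϖ ^ n := by rw [hb₀, map_div₀, h1g, div_one]; exact hrg
  obtain ⟨b, hbB, hbb⟩ := hB2 b₀ hσb₀ hvb₀
  refine ⟨g + (1 + g) * b, Finset.mem_image.2 ⟨(g, b), Finset.mem_product.2 ⟨Finset.mem_filter.2 ⟨hgR, hge⟩, hbB⟩, rfl⟩, ?_⟩
  rw [show r - (g + (1 + g) * b) = (1 + g) * (b₀ - b) by rw [hb₀]; field_simp; ring, map_mul, h1g, one_mul]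
  exact hbb

omit [DecidableEq K] in
/-- (d) THE MAP IS INJECTIVE ON `R.filter cut ×ˢ B` (`1 ≤ e`, `1 ≤ n ≤ N`, `|1 − c₀| = 1`; `R` irredundant modulo `𝔭ⁿ`, `B` irredundant modulo `𝔭^N`). [cite: Serre1979, Ch. II §1] -/
theorem glueShell_injOn_unit (hϖ : Valued.v ϖ = exp (-1 : ℤ)) {e n N : ℕ} (he : 1 ≤ e) (hn : 1 ≤ n) (hnN : n ≤ N) {c₀ : K} (h1c₀ : Valued.v (1 - c₀) = 1)
    (R : Finset K) (hR3 : ∀ g ∈ R, ∀ g' ∈ R, Valued.v (g - g') ≤ Valued.v ϖ ^ n → g = g')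
    (B : Finset K) (hB1 : ∀ b ∈ B, σ b = b ∧ Valued.v b ≤ Valued.v ϖ ^ n) (hB3 : ∀ b ∈ B, ∀ b' ∈ B, Valued.v (b - b') ≤ Valued.v ϖ ^ N → b = b') :
    Set.InjOn (fun p : K × K => p.1 + (1 + p.1) * p.2) ↑((R.filter fun g => Valued.v (g + c₀) = Valued.v ϖ ^ e) ×ˢ B) := by
  rintro ⟨g, b⟩ hgb ⟨g', b'⟩ hgb' heq
  rw [Finset.mem_coe, Finset.mem_product] at hgb hgb'
  obtain ⟨hgR, hge⟩ := Finset.mem_filter.1 hgb.1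
  have hgR' := (Finset.mem_filter.1 hgb'.1).1
  have heq' : g + (1 + g) * b = g' + (1 + g') * b' := heq
  have hxx' : Valued.v ((g + (1 + g) * b) - (g' + (1 + g') * b')) ≤ Valued.v ϖ ^ N := by rw [heq', sub_self, map_zero]; exact zero_le
  obtain ⟨hgg', hbb'⟩ := v_sub_le_and_of_v_linear_sub_le_unit hϖ hn hnN (one_add_eq_of_cut hϖ he h1c₀ hge) (hB1 b hgb.2).2 (hB1 b' hgb'.2).2 hxx'
  have hgeq : g = g' := hR3 g hgR g' hgR' hgg'
  have hbeq : b = b' := hB3 b hgb.2 b' hgb'.2 (hbb' hgeq)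
  rw [hgeq, hbeq]

/-- (c) THE IMAGE IS IRREDUNDANT modulo `𝔭^N` (same data). [cite: Serre1979, Ch. II §1] -/
theorem glueShell_image_irredundant_unit (hϖ : Valued.v ϖ = exp (-1 : ℤ)) {e n N : ℕ} (he : 1 ≤ e) (hn : 1 ≤ n) (hnN : n ≤ N) {c₀ : K} (h1c₀ : Valued.v (1 - c₀) = 1)
    (R : Finset K) (hR3 : ∀ g ∈ R, ∀ g' ∈ R, Valued.v (g - g') ≤ Valued.v ϖ ^ n → g = g')
    (B : Finset K) (hB1 : ∀ b ∈ B, σ b = b ∧ Valued.v b ≤ Valued.v ϖ ^ n) (hB3 : ∀ b ∈ B, ∀ b' ∈ B, Valued.v (b - b') ≤ Valued.v ϖ ^ N → b = b') :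
    ∀ x ∈ ((R.filter fun g => Valued.v (g + c₀) = Valued.v ϖ ^ e) ×ˢ B).image (fun p : K × K => p.1 + (1 + p.1) * p.2),
      ∀ x' ∈ ((R.filter fun g => Valued.v (g + c₀) = Valued.v ϖ ^ e) ×ˢ B).image (fun p : K × K => p.1 + (1 + p.1) * p.2),
        Valued.v (x - x') ≤ Valued.v ϖ ^ N → x = x' := by
  intro x hx x' hx' hxx'
  obtain ⟨⟨g, b⟩, hgb, rfl⟩ := Finset.mem_image.1 hx
  obtain ⟨⟨g', b'⟩, hgb', rfl⟩ := Finset.mem_image.1 hx'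
  obtain ⟨hg, hb⟩ := Finset.mem_product.1 hgb
  obtain ⟨hg', hb'⟩ := Finset.mem_product.1 hgb'
  obtain ⟨hgR, hge⟩ := Finset.mem_filter.1 hg
  have hgR' := (Finset.mem_filter.1 hg').1
  obtain ⟨hgg', hbb'⟩ := v_sub_le_and_of_v_linear_sub_le_unit hϖ hn hnN (one_add_eq_of_cut hϖ he h1c₀ hge) (hB1 b hb).2 (hB1 b' hb').2 hxx'
  have hgeq : g = g' := hR3 g hgR g' hgR' hgg'
  have hbeq : b = b' := hB3 b hb b' hb' (hbb' hgeq)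
  subst hgeq; subst hbeq; rfl

/-- (e) THE WINDOW DOUBLE SUM IS A SINGLE SUM OVER THE IMAGE SYSTEM (`Finset.sum_product` + `Finset.sum_image` on (d)). [cite: Serre1979, Ch. II §1] -/
theorem sum_sum_glueShell_eq_sum_image_unit {M : Type} [AddCommMonoid M] (hϖ : Valued.v ϖ = exp (-1 : ℤ)) {e n N : ℕ} (he : 1 ≤ e) (hn : 1 ≤ n) (hnN : n ≤ N)
    {c₀ : K} (h1c₀ : Valued.v (1 - c₀) = 1) (R : Finset K) (hR3 : ∀ g ∈ R, ∀ g' ∈ R, Valued.v (g - g') ≤ Valued.v ϖ ^ n → g = g')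
    (B : Finset K) (hB1 : ∀ b ∈ B, σ b = b ∧ Valued.v b ≤ Valued.v ϖ ^ n) (hB3 : ∀ b ∈ B, ∀ b' ∈ B, Valued.v (b - b') ≤ Valued.v ϖ ^ N → b = b')
    (G : K → M) :
    ∑ g ∈ R.filter (fun g => Valued.v (g + c₀) = Valued.v ϖ ^ e), ∑ b ∈ B, G (g + (1 + g) * b) =
      ∑ r ∈ ((R.filter fun g => Valued.v (g + c₀) = Valued.v ϖ ^ e) ×ˢ B).image (fun p : K × K => p.1 + (1 + p.1) * p.2), G r := by
  rw [Finset.sum_image (glueShell_injOn_unit hϖ he hn hnN h1c₀ R hR3 B hB1 hB3), Finset.sum_product]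

/-- **THE `s = 0` GLUE-WINDOW DOUBLE SUM OF A SHELL-VANISHING SUMMAND VANISHES**: window data `1 ≤ e < n ≤ 2M`, `2M ≤ k + d ≤ 2M + 1`, `d ≤ M ≤ k`, `|1 − c₀| = 1`; for any
`G : K → ℤ` whose sum over EVERY complete irredundant system modulo `𝔭^{2M}` of the unit shell `{σr = r, |r| = |ϖ|^0, |r + c₀| = |ϖ|^e}` is `0`:
`Σ_{g ∈ R.filter cut} Σ_{aβ ∈ Aβ} G(g + (1+g)(aβ − 1)) = 0`. [cite: Serre1979, Ch. II §1] -/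
theorem sum_filter_sum_eq_zero_of_shell_unit [CompleteSpace K] (hD : IsRamifiedQuadraticDatum σ ϖ d t)
    {n k M e : ℕ} (he : 1 ≤ e) (hen : e < n) (hnM : n ≤ 2 * M) (hMk : 2 * M ≤ k + d) (hkM : k + d ≤ 2 * M + 1) (hdM : d ≤ M) (hMk2 : M ≤ k)
    {c₀ : K} (h1c₀ : Valued.v (1 - c₀) = 1) (R : Finset K) (hR1 : ∀ g ∈ R, σ g = g ∧ Valued.v g = 1)
    (hR2 : ∀ f : K, σ f = f → Valued.v f = 1 → ∃ g ∈ R, Valued.v (f - g) ≤ Valued.v ϖ ^ n)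
    (hR3 : ∀ g ∈ R, ∀ g' ∈ R, Valued.v (g - g') ≤ Valued.v ϖ ^ n → g = g')
    (Aβ : Finset K) (hAβsub : ∀ a ∈ Aβ, σ a = a ∧ Valued.v (a - 1) ≤ Valued.v ϖ ^ n)
    (hAβ : ∀ y : K, σ y = y → Valued.v (y - 1) ≤ Valued.v ϖ ^ n → ∃! a, a ∈ Aβ ∧ ∃ s : K, Valued.v (s - 1) ≤ Valued.v ϖ ^ k ∧ s * σ s = a / y)
    (G : K → ℤ)
    (hG : ∀ Sh : Finset K, (∀ r ∈ Sh, σ r = r ∧ Valued.v r = Valued.v ϖ ^ 0 ∧ Valued.v (r + c₀) = Valued.v ϖ ^ e) →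
      (∀ r : K, σ r = r → Valued.v r = Valued.v ϖ ^ 0 → Valued.v (r + c₀) = Valued.v ϖ ^ e → ∃ x ∈ Sh, Valued.v (r - x) ≤ Valued.v ϖ ^ (2 * M)) →
      (∀ x ∈ Sh, ∀ x' ∈ Sh, Valued.v (x - x') ≤ Valued.v ϖ ^ (2 * M) → x = x') → ∑ r ∈ Sh, G r = 0) :
    ∑ g ∈ R.filter (fun g => Valued.v (g + c₀) = Valued.v ϖ ^ e), ∑ a ∈ Aβ, G (g + (1 + g) * (a - 1)) = 0 := by
  obtain ⟨-, -, hϖ, -, -, -, -⟩ := id hD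
  have hn : 1 ≤ n := by omega
  obtain ⟨hB1, hB2, hB3⟩ := image_sub_one_repr hD hn hMk hkM hdM hMk2 Aβ hAβsub hAβ
  have hinj : Set.InjOn (fun a : K => a - 1) ↑Aβ := fun a _ a' _ h => sub_left_injective h
  have hinner : ∀ g : K, ∑ a ∈ Aβ, G (g + (1 + g) * (a - 1)) = ∑ b ∈ Aβ.image (fun a => a - 1), G (g + (1 + g) * b) := fun g => by rw [Finset.sum_image hinj]
  rw [Finset.sum_congr rfl fun g _ => hinner g, sum_sum_glueShell_eq_sum_image_unit (σ := σ) hϖ he hn hnM h1c₀ R hR3 _ hB1 hB3 G]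
  exact hG _ (glueShell_image_sub_unit hϖ hn hen R hR1 _ hB1) (glueShell_image_complete_unit hϖ he hen h1c₀ R hR1 hR2 _ hB2)
    (glueShell_image_irredundant_unit hϖ he hn hnM h1c₀ R hR3 _ hB1 hB3)

end Linearisation

/-! ## §5  HEADS — the three `s = 0` glue-window double sums vanish -/

section Window

variable [CompleteSpace K] [Finite 𝓀[K]] [DecidableEq K]

/-- **HEAD, SLOT 1 (`s = 0`): `Σ_{g ∈ R.filter cut} Σ_{aβ ∈ Aβ} ω((g + (1+g)(aβ − 1)) + c₀) = 0`** (`2 ≤ d`; `c₀` a fixed unit with `|1 − c₀| = 1`; `R` the fixed units modulo `𝔭ⁿ`;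
window data `1 ≤ e < n ≤ 2M`, `e + 2d − 1 ≤ 2M`, `2M ≤ k + d ≤ 2M + 1`, `d ≤ M ≤ k`). [cite: Serre1979, Ch. V §3 Cor. 3; Ch. XV §2] -/
theorem sum_filter_sum_normSign_add_eq_zero_unit (hD : IsRamifiedQuadraticDatum σ ϖ d t) (h2v : Valued.v (2 : K) < 1) (h2d : 2 ≤ d)
    {n k M e : ℕ} (he : 1 ≤ e) (hen : e < n) (hnM : n ≤ 2 * M) (heM : e + (2 * d - 1) ≤ 2 * M)
    (hMk : 2 * M ≤ k + d) (hkM : k + d ≤ 2 * M + 1) (hdM : d ≤ M) (hMk2 : M ≤ k)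
    {c₀ : K} (hσc₀ : σ c₀ = c₀) (hc₀ : Valued.v c₀ = 1) (h1c₀ : Valued.v (1 - c₀) = 1) (R : Finset K) (hR1 : ∀ g ∈ R, σ g = g ∧ Valued.v g = 1)
    (hR2 : ∀ f : K, σ f = f → Valued.v f = 1 → ∃ g ∈ R, Valued.v (f - g) ≤ Valued.v ϖ ^ n)
    (hR3 : ∀ g ∈ R, ∀ g' ∈ R, Valued.v (g - g') ≤ Valued.v ϖ ^ n → g = g')
    (Aβ : Finset K) (hAβsub : ∀ a ∈ Aβ, σ a = a ∧ Valued.v (a - 1) ≤ Valued.v ϖ ^ n)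
    (hAβ : ∀ y : K, σ y = y → Valued.v (y - 1) ≤ Valued.v ϖ ^ n → ∃! a, a ∈ Aβ ∧ ∃ s : K, Valued.v (s - 1) ≤ Valued.v ϖ ^ k ∧ s * σ s = a / y) :
    ∑ g ∈ R.filter (fun g => Valued.v (g + c₀) = Valued.v ϖ ^ e), ∑ a ∈ Aβ, normSign σ ((g + (1 + g) * (a - 1)) + c₀) = 0 :=
  sum_filter_sum_eq_zero_of_shell_unit hD he hen hnM hMk hkM hdM hMk2 h1c₀ R hR1 hR2 hR3 Aβ hAβsub hAβ (fun r => normSign σ (r + c₀))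
    (fun Sh h1 h2 h3 => sum_normSign_add_shell_eq_zero_unit hD h2v h2d he heM hσc₀ hc₀ h1c₀ Sh h1 h2 h3)

/-- **HEAD, SLOT 0 (`s = 0`): `Σ_{g ∈ R.filter cut} Σ_{aβ ∈ Aβ} ω(r·(r + c₀)) = 0`, `r = g + (1+g)(aβ − 1)`** (data as in slot 1). [cite: IrelandRosen1990, Ch. 8 §3] [cite: Serre1979, Ch. XV §2] -/
theorem sum_filter_sum_normSign_mul_add_eq_zero_unit (hD : IsRamifiedQuadraticDatum σ ϖ d t) (h2v : Valued.v (2 : K) < 1) (h2d : 2 ≤ d)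
    {n k M e : ℕ} (he : 1 ≤ e) (hen : e < n) (hnM : n ≤ 2 * M) (heM : e + (2 * d - 1) ≤ 2 * M)
    (hMk : 2 * M ≤ k + d) (hkM : k + d ≤ 2 * M + 1) (hdM : d ≤ M) (hMk2 : M ≤ k)
    {c₀ : K} (hσc₀ : σ c₀ = c₀) (hc₀ : Valued.v c₀ = 1) (h1c₀ : Valued.v (1 - c₀) = 1) (R : Finset K) (hR1 : ∀ g ∈ R, σ g = g ∧ Valued.v g = 1)
    (hR2 : ∀ f : K, σ f = f → Valued.v f = 1 → ∃ g ∈ R, Valued.v (f - g) ≤ Valued.v ϖ ^ n)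
    (hR3 : ∀ g ∈ R, ∀ g' ∈ R, Valued.v (g - g') ≤ Valued.v ϖ ^ n → g = g')
    (Aβ : Finset K) (hAβsub : ∀ a ∈ Aβ, σ a = a ∧ Valued.v (a - 1) ≤ Valued.v ϖ ^ n)
    (hAβ : ∀ y : K, σ y = y → Valued.v (y - 1) ≤ Valued.v ϖ ^ n → ∃! a, a ∈ Aβ ∧ ∃ s : K, Valued.v (s - 1) ≤ Valued.v ϖ ^ k ∧ s * σ s = a / y) :
    ∑ g ∈ R.filter (fun g => Valued.v (g + c₀) = Valued.v ϖ ^ e), ∑ a ∈ Aβ,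
      normSign σ ((g + (1 + g) * (a - 1)) * ((g + (1 + g) * (a - 1)) + c₀)) = 0 :=
  sum_filter_sum_eq_zero_of_shell_unit hD he hen hnM hMk hkM hdM hMk2 h1c₀ R hR1 hR2 hR3 Aβ hAβsub hAβ (fun r => normSign σ (r * (r + c₀)))
    (fun Sh h1 h2 h3 => sum_normSign_mul_add_shell_eq_zero_unit hD h2v h2d he heM hσc₀ hc₀ h1c₀ Sh h1 h2 h3)

/-- **HEAD, SLOT 2 (`s = 0`): `Σ_{g ∈ R.filter cut} Σ_{aβ ∈ Aβ} ω((1 + r)·(r + c₀)) = 0`, `r = g + (1+g)(aβ − 1)`** (data as in slot 1). [cite: Serre1979, Ch. V §3 Cor. 3; Ch. XV §2] -/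
theorem sum_filter_sum_normSign_one_add_mul_add_eq_zero_unit (hD : IsRamifiedQuadraticDatum σ ϖ d t) (h2v : Valued.v (2 : K) < 1) (h2d : 2 ≤ d)
    {n k M e : ℕ} (he : 1 ≤ e) (hen : e < n) (hnM : n ≤ 2 * M) (heM : e + (2 * d - 1) ≤ 2 * M)
    (hMk : 2 * M ≤ k + d) (hkM : k + d ≤ 2 * M + 1) (hdM : d ≤ M) (hMk2 : M ≤ k)
    {c₀ : K} (hσc₀ : σ c₀ = c₀) (hc₀ : Valued.v c₀ = 1) (h1c₀ : Valued.v (1 - c₀) = 1) (R : Finset K) (hR1 : ∀ g ∈ R, σ g = g ∧ Valued.v g = 1)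
    (hR2 : ∀ f : K, σ f = f → Valued.v f = 1 → ∃ g ∈ R, Valued.v (f - g) ≤ Valued.v ϖ ^ n)
    (hR3 : ∀ g ∈ R, ∀ g' ∈ R, Valued.v (g - g') ≤ Valued.v ϖ ^ n → g = g')
    (Aβ : Finset K) (hAβsub : ∀ a ∈ Aβ, σ a = a ∧ Valued.v (a - 1) ≤ Valued.v ϖ ^ n)
    (hAβ : ∀ y : K, σ y = y → Valued.v (y - 1) ≤ Valued.v ϖ ^ n → ∃! a, a ∈ Aβ ∧ ∃ s : K, Valued.v (s - 1) ≤ Valued.v ϖ ^ k ∧ s * σ s = a / y) :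
    ∑ g ∈ R.filter (fun g => Valued.v (g + c₀) = Valued.v ϖ ^ e), ∑ a ∈ Aβ,
      normSign σ ((1 + (g + (1 + g) * (a - 1))) * ((g + (1 + g) * (a - 1)) + c₀)) = 0 :=
  sum_filter_sum_eq_zero_of_shell_unit hD he hen hnM hMk hkM hdM hMk2 h1c₀ R hR1 hR2 hR3 Aβ hAβsub hAβ (fun r => normSign σ ((1 + r) * (r + c₀)))
    (fun Sh h1 h2 h3 => sum_normSign_one_add_mul_add_shell_eq_zero_unit hD h2v h2d he heM hσc₀ hc₀ h1c₀ Sh h1 h2 h3)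

end Window

end Summit.HodgeConjecture.HodgeConjecture.Cruxes.H413.F0P3cDyRamGlueWindowVanishingUnit
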